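import Summits.HodgeConjecture.HodgeConjecture.Theorems.PadicSemiregularLiftHodgeFermatVarietiesFiveQStructure
import HarnessLib

/-!
# Hodge sextuples of level `5q`, II: the structure of the unit entries — line `cancel-by-any-claim-lattice`, crux `HodgeFermatVarieties` (stmt-HodgeConjecture-1334)

Third file of lead c3's level-`5q` programme (prime `q ≥ 7`). With `c(x)` the multiplicity of `x` in a Hodge
SEXTUPLE `s` of `ℤ/5q` and `o = G + H` the split of `…FiveQStructure` (`units_oddPart_split`):

* `fibre_sum_count'` — the mirror fibre sums: `n'(a) - n'(-a) = (q - 1) H(a)` for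
  `n'(a) = Σ_{x ≡ a (5), x unit} c(x)`;
* `fibreCount_even_of_units` — if ALL entries of `s` are units and `χ(q) ≠ 1` for the odd characters `χ`
  mod `5` (e.g. `q = 7`), then (III) makes `n'` even, hence `H = 0`;
* `structure_units` — **either the unit part of `s` is symmetric (`c(x) = c(-x)` for every unit `x`), or
  for some `b₁ ∈ (ℤ/q)ˣ`: `c(x) ≥ c(-x) + 1` on the fibre `{x ≡ b₁ (q)}` and `c(x) = c(-x)` for the units off
  the fibres of `±b₁`** (counting: module docstring of `…FiveQStructure`).

References: [Aoki1983] N. Aoki, Math. Ann. 266 (1983) §2, §7 (Thm A′).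
-/

set_option linter.dupNamespace false

noncomputable section

open Finset
open Literature.AlgebraicGeometry.HodgeTheory Literature.AlgebraicGeometry.HodgeTheory.FermatCharacter

namespace Summit.HodgeConjecture.HodgeConjecture.Theorems.CancelByAnyClaimLattice.FiveQ

/-! ### §1 Sums over residues versus sums over units -/

/-- A sum over `ℤ/m` of a function vanishing off the units is the sum over the unit group. [folklore] -/
theorem sum_univ_eq_sum_units {m : ℕ} [NeZero m] (g : ZMod m → ℂ) (hg : ∀ y, ¬ IsUnit y → g y = 0) :
    ∑ y : ZMod m, g y = ∑ x : (ZMod m)ˣ, g x := by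
  classical
  rw [← Finset.sum_filter_of_ne (p := fun y : ZMod m ↦ IsUnit y) (fun y _ hy ↦ by
    by_contra h; exact hy (hg y h))]
  refine Finset.sum_nbij' (fun y ↦ if h : IsUnit y then h.unit else 1) (fun x ↦ (x : ZMod m))
    (fun _ _ ↦ mem_univ _) (fun x _ ↦ by simp) (fun y hy ↦ ?_) (fun x _ ↦ ?_) (fun y hy ↦ ?_)
  · simp only [mem_filter, mem_univ, true_and] at hy
    simp [hy]
  · simp [Units.isUnit x]
  · simp only [mem_filter, mem_univ, true_and] at hy
    simp [hy]

section Level5q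

variable {q : ℕ} [Fact q.Prime]

/-! ### §2 The mirror fibre sums -/

/-- **Mirror fibre sums of `o`**: `n'(a) - n'(-a) = (q-1) H(a)`. [folklore] -/
theorem fibre_sum_count' (hq : 7 ≤ q) {s : Multiset (ZMod (5 * q))} {G : (ZMod q)ˣ → ℂ} {H : (ZMod 5)ˣ → ℂ}
    (hG : ∀ b, G (-b) = -G b)
    (ho : ∀ x : (ZMod (5 * q))ˣ, (Multiset.count (x : ZMod (5 * q)) s : ℂ) - Multiset.count (-(x : ZMod (5 * q))) s =
      G (ZMod.unitsMap (dvd_mul_left q 5) x) + H (ZMod.unitsMap (dvd_mul_right 5 q) x))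
    (a : (ZMod 5)ˣ) :
    (∑ x ∈ univ.filter (fun x : (ZMod (5 * q))ˣ ↦ ZMod.unitsMap (dvd_mul_right 5 q) x = a),
        (Multiset.count (x : ZMod (5 * q)) s : ℂ)) -
      ∑ x ∈ univ.filter (fun x : (ZMod (5 * q))ˣ ↦ ZMod.unitsMap (dvd_mul_right 5 q) x = -a),
        (Multiset.count (x : ZMod (5 * q)) s : ℂ) = (q - 1 : ℕ) * H a := by
  classical
  have hpq : (5 : ℕ) ≠ q := five_ne hq
  have hneg : ∑ x ∈ univ.filter (fun x : (ZMod (5 * q))ˣ ↦ ZMod.unitsMap (dvd_mul_right 5 q) x = -a),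
      (Multiset.count (x : ZMod (5 * q)) s : ℂ) =
      ∑ x ∈ univ.filter (fun x : (ZMod (5 * q))ˣ ↦ ZMod.unitsMap (dvd_mul_right 5 q) x = a),
        (Multiset.count (-(x : ZMod (5 * q))) s : ℂ) := by
    refine Finset.sum_nbij' (fun x ↦ -x) (fun x ↦ -x) (fun x hx ↦ ?_) (fun x hx ↦ ?_) (fun x _ ↦ neg_neg x)
      (fun x _ ↦ neg_neg x) (fun x _ ↦ by rw [Units.val_neg, neg_neg])
    · simp only [mem_filter, mem_univ, true_and] at hx ⊢
      rw [unitsMap_neg, hx, neg_neg]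
    · simp only [mem_filter, mem_univ, true_and] at hx ⊢
      rw [unitsMap_neg, hx]
  rw [hneg, ← Finset.sum_sub_distrib]
  have h1 : ∑ x ∈ univ.filter (fun x : (ZMod (5 * q))ˣ ↦ ZMod.unitsMap (dvd_mul_right 5 q) x = a),
      ((Multiset.count (x : ZMod (5 * q)) s : ℂ) - Multiset.count (-(x : ZMod (5 * q))) s) =
      ∑ x ∈ univ.filter (fun x : (ZMod (5 * q))ˣ ↦ ZMod.unitsMap (dvd_mul_right 5 q) x = a),
        (G (ZMod.unitsMap (dvd_mul_left q 5) x) + H a) := by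
    refine Finset.sum_congr rfl fun x hx ↦ ?_
    simp only [mem_filter, mem_univ, true_and] at hx
    rw [ho x, hx]
  rw [h1, Finset.sum_add_distrib, Finset.sum_const, card_fibre' hpq a, sum_fibre_eq_sum_units' hpq a G,
    sum_units_eq_zero_of_odd hG, zero_add, nsmul_eq_mul]

/-! ### §3 All entries units: (III) makes the mirror fibre counts even -/

/-- The mirror fibre count as a filter-cardinality when all entries are units:
`Σ_{x unit, x ≡ a (5)} c(x) = #{x ∈ s : x ≡ a (5)}`. [folklore] -/
theorem fibre_count_eq_card_filter {s : Multiset (ZMod (5 * q))} (hu : ∀ x ∈ s, IsUnit x) (a : (ZMod 5)ˣ) :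
    ∑ x ∈ univ.filter (fun x : (ZMod (5 * q))ˣ ↦ ZMod.unitsMap (dvd_mul_right 5 q) x = a),
        (Multiset.count (x : ZMod (5 * q)) s : ℂ) =
      Multiset.card (s.filter fun y ↦ ZMod.castHom (dvd_mul_right 5 q) (ZMod 5) y = a) := by
  classical
  -- the cardinality of the filter as a multiset sum, then as a sum over residues
  have hcard : (Multiset.card (s.filter fun y ↦ ZMod.castHom (dvd_mul_right 5 q) (ZMod 5) y = a) : ℂ) =
      (s.map fun y ↦ if ZMod.castHom (dvd_mul_right 5 q) (ZMod 5) y = a then (1 : ℂ) else 0).sum := by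
    rw [← Multiset.countP_eq_card_filter, Multiset.countP_eq_card_filter]
    induction s using Multiset.induction_on with
    | empty => simp
    | cons y t ih =>
      rw [Multiset.filter_cons, Multiset.card_add, Nat.cast_add, Multiset.map_cons, Multiset.sum_cons, ih]
      · split_ifs <;> simp
      · exact fun x hx ↦ hu x (Multiset.mem_cons_of_mem hx)
  rw [hcard, multiset_sum_eq_sum_count, sum_univ_eq_sum_units]
  · rw [Finset.sum_filter]
    refine Finset.sum_congr rfl fun x _ ↦ ?_
    have hiff : ZMod.unitsMap (dvd_mul_right 5 q) x = a ↔
        ZMod.castHom (dvd_mul_right 5 q) (ZMod 5) (x : ZMod (5 * q)) = a := by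
      rw [Units.ext_iff, coe_unitsMap]
    by_cases hx : ZMod.unitsMap (dvd_mul_right 5 q) x = a
    · rw [if_pos hx, if_pos (hiff.mp hx), mul_one]
    · rw [if_neg hx, if_neg (fun h ↦ hx (hiff.mpr h)), mul_zero]
  · intro y hy
    have : Multiset.count y s = 0 := Multiset.count_eq_zero.mpr fun hmem ↦ hy (hu y hmem)
    rw [this, Nat.cast_zero, zero_mul]

omit [Fact q.Prime] in
/-- **Push-forward to `ℤ/5` against a character**: `Σ_y #{x ∈ t : x ≡ y (5)} ψ(y) = Σ_{x ∈ t} ψ(x mod 5)`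
for every multiset `t`. [folklore] -/
theorem sum_card_filter_mul (t : Multiset (ZMod (5 * q))) (ψ : DirichletCharacter ℂ 5) :
    ∑ y : ZMod 5, (Multiset.card (t.filter fun x ↦ ZMod.castHom (dvd_mul_right 5 q) (ZMod 5) x = y) : ℂ) * ψ y =
      (t.map fun x ↦ ψ (ZMod.castHom (dvd_mul_right 5 q) (ZMod 5) x)).sum := by
  classical
  induction t using Multiset.induction_on with
  | empty => simp
  | cons x t ih =>
    rw [Multiset.map_cons, Multiset.sum_cons, ← ih]
    have hsplit : ∀ y : ZMod 5,
        (Multiset.card ((x ::ₘ t).filter fun z ↦ ZMod.castHom (dvd_mul_right 5 q) (ZMod 5) z = y) : ℂ) * ψ y =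
          (if ZMod.castHom (dvd_mul_right 5 q) (ZMod 5) x = y then ψ y else 0) +
            (Multiset.card (t.filter fun z ↦ ZMod.castHom (dvd_mul_right 5 q) (ZMod 5) z = y) : ℂ) * ψ y := by
      intro y
      rw [Multiset.filter_cons]
      split_ifs with hxy
      · simp; ring
      · simp
    rw [Finset.sum_congr rfl fun y _ ↦ hsplit y, Finset.sum_add_distrib, Finset.sum_ite_eq]
    simp

/-- **If all entries are units and `χ(q) ≠ 1` for the odd characters mod `5`, the mirror fibre counts are
even**: (III) reduces to `Σ_{x ∈ s} χ(x mod 5)⁻¹ = 0` for every odd `χ` mod `5`, i.e. the push-forward of `s`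
to `ℤ/5` is orthogonal to the odd characters, hence even (`even_of_orthogonal_odd`).
[cite: Aoki1983, Prop. 2.2] -/
theorem fibreCount_even_of_units (hq : 7 ≤ q) {s : Multiset (ZMod (5 * q))} (hs : IsHodgeMultiset s)
    (hu : ∀ x ∈ s, IsUnit x) (hχq : ∀ χ : DirichletCharacter ℂ 5, χ (-1) = -1 → χ (q : ZMod 5) ≠ 1)
    (a : (ZMod 5)ˣ) :
    ∑ x ∈ univ.filter (fun x : (ZMod (5 * q))ˣ ↦ ZMod.unitsMap (dvd_mul_right 5 q) x = a),
        (Multiset.count (x : ZMod (5 * q)) s : ℂ) =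
      ∑ x ∈ univ.filter (fun x : (ZMod (5 * q))ˣ ↦ ZMod.unitsMap (dvd_mul_right 5 q) x = -a),
        (Multiset.count (x : ZMod (5 * q)) s : ℂ) := by
  classical
  have hpq : (5 : ℕ) ≠ q := five_ne hq
  rw [fibre_count_eq_card_filter hu, fibre_count_eq_card_filter hu, Units.val_neg]
  -- `F(y) = #{x ∈ s : x ≡ y (5)}` is orthogonal to the odd characters mod `5`
  refine even_of_orthogonal_odd
    (fun y ↦ (Multiset.card (s.filter fun x ↦ ZMod.castHom (dvd_mul_right 5 q) (ZMod 5) x = y) : ℂ))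
    (fun ψ hψ ↦ ?_) a
  rw [sum_card_filter_mul]
  -- (III) for the odd character `ψ⁻¹`, all entries being units
  have key := stub_twoPrime_level_left 5 q hpq s hs ψ⁻¹ (inv_neg_one_of_odd hψ) (ne_one_of_odd (inv_neg_one_of_odd hψ))
  have hterm : ∀ x ∈ s, (if IsUnit x then (1 - ψ⁻¹ (q : ZMod 5)) else ((q - 1 : ℕ) : ℂ) * ψ⁻¹ (q : ZMod 5)) *
      (ψ⁻¹ (ZMod.castHom (dvd_mul_right 5 q) (ZMod 5) x))⁻¹ =
      (1 - ψ⁻¹ (q : ZMod 5)) * ψ (ZMod.castHom (dvd_mul_right 5 q) (ZMod 5) x) := by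
    intro x hx
    rw [if_pos (hu x hx), inv_inv_apply]
  rw [Multiset.map_congr rfl hterm, Multiset.sum_map_mul_left] at key
  have hne : (1 - ψ⁻¹ (q : ZMod 5)) ≠ 0 := sub_ne_zero.mpr (hχq ψ⁻¹ (inv_neg_one_of_odd hψ)).symm
  exact (mul_eq_zero.mp key).resolve_left hne

/-! ### §4 The structure of the unit entries -/

/-- **STRUCTURE OF THE UNIT ENTRIES OF A HODGE SEXTUPLE OF LEVEL `5q`** (`q ≥ 7` prime): either the unit
part is symmetric, `c(x) = c(-x)` for every unit `x`; or for some `b₁ ∈ (ℤ/q)ˣ` the whole fibre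
`{x ≡ b₁ (q)}` of units is occupied, `c(x) ≥ c(-x) + 1` there, and `c(x) = c(-x)` for the units off the
fibres of `±b₁`. Proof by counting the support of `o = c - c∘neg = G + H` (module docstrings).
[cite: Aoki1983, Thm. A′ (§7)] -/
theorem structure_units : ∀ {q : ℕ} [Fact q.Prime], 7 ≤ q → ∀ {s : Multiset (ZMod (5 * q))}, IsHodgeMultiset s →
    Multiset.card s = 6 →
    (∀ x : (ZMod (5 * q))ˣ, Multiset.count (x : ZMod (5 * q)) s = Multiset.count (-(x : ZMod (5 * q))) s) ∨
    ∃ b₁ : (ZMod q)ˣ,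
      (∀ x : (ZMod (5 * q))ˣ, ZMod.unitsMap (dvd_mul_left q 5) x = b₁ →
        Multiset.count (-(x : ZMod (5 * q))) s + 1 ≤ Multiset.count (x : ZMod (5 * q)) s) ∧
      (∀ x : (ZMod (5 * q))ˣ, ZMod.unitsMap (dvd_mul_left q 5) x ≠ b₁ → ZMod.unitsMap (dvd_mul_left q 5) x ≠ -b₁ →
        Multiset.count (x : ZMod (5 * q)) s = Multiset.count (-(x : ZMod (5 * q))) s) := by
  intro q _ hq s hs h6
  classical
  have hpq : (5 : ℕ) ≠ q := five_ne hq
  obtain ⟨G, H, hG, hH, ho⟩ := units_oddPart_split hq hs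
  have hA : Multiset.card (s.filter IsUnit) ≤ 6 := (Multiset.card_le_card (Multiset.filter_le _ _)).trans h6.le
  have hsupp_le := card_support_le ho
  -- Case 1: `H ≢ 0` is impossible
  by_cases hH0 : ∃ a, H a ≠ 0
  · exfalso
    have hge := card_support_ge hq (G := G) hH hH0
    have hq7 : q = 7 := by omega
    -- all entries are units
    have hAll : Multiset.card (s.filter IsUnit) = Multiset.card s := by omega
    have hu : ∀ x ∈ s, IsUnit x := by
      have := Multiset.filter_eq_self.mp (Multiset.eq_of_le_of_card_le (Multiset.filter_le IsUnit s) hAll.ge)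
      exact this
    subst hq7
    -- (III): the mirror fibre counts are even, hence `H = 0`
    have hχq : ∀ χ : DirichletCharacter ℂ 5, χ (-1) = -1 → χ ((7 : ℕ) : ZMod 5) ≠ 1 := fun χ hχ ↦ by
      rw [show ((7 : ℕ) : ZMod 5) = 2 by decide]
      exact char_five_two_ne_one χ hχ
    obtain ⟨a, ha⟩ := hH0
    have h1 := fibre_sum_count' (le_refl 7) hG ho a
    rw [fibreCount_even_of_units (le_refl 7) hs hu hχq a, sub_self] at h1
    have : ((7 - 1 : ℕ) : ℂ) ≠ 0 := by norm_num
    exact ha ((mul_eq_zero.mp h1.symm).resolve_left this)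
  -- Case 2: `H ≡ 0`
  push Not at hH0
  have ho' : ∀ x : (ZMod (5 * q))ˣ, (Multiset.count (x : ZMod (5 * q)) s : ℂ) - Multiset.count (-(x : ZMod (5 * q))) s =
      G (ZMod.unitsMap (dvd_mul_left q 5) x) := fun x ↦ by rw [ho x, hH0, add_zero]
  by_cases hG0 : ∀ b, G b = 0
  · -- symmetric unit part
    left
    intro x
    have h := ho' x
    rw [hG0, sub_eq_zero] at h
    exact_mod_cast h
  · right
    push Not at hG0
    -- the support of `G` is `{b₀, -b₀}`: it is negation-stable without fixed points and has ≤ 3 elements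
    set SG : Finset (ZMod q)ˣ := univ.filter fun b ↦ G b ≠ 0 with hSG
    have hSGneg : ∀ b, b ∈ SG ↔ -b ∈ SG := fun b ↦ by
      simp only [hSG, mem_filter, mem_univ, true_and, hG b, neg_ne_zero]
    have hfix : ∀ b : (ZMod q)ˣ, b ≠ -b := by
      intro b hb
      have h2 : (2 : ZMod q) * (b : ZMod q) = 0 := by
        have := congrArg (fun u : (ZMod q)ˣ ↦ (u : ZMod q)) hb
        simp only [Units.val_neg] at this
        linear_combination this
      rcases mul_eq_zero.mp h2 with h | h
      · have hq2 : (q : ℕ) ∣ 2 := by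
          have : ((2 : ℕ) : ZMod q) = 0 := by exact_mod_cast h
          exact (ZMod.natCast_eq_zero_iff 2 q).mp this
        have := Nat.le_of_dvd two_pos hq2
        omega
      · exact (Units.ne_zero b) h
    -- the support of `o` is the union of the fibres over `SG`
    have hsupp_eq : #(univ.filter fun x : (ZMod (5 * q))ˣ ↦
        G (ZMod.unitsMap (dvd_mul_left q 5) x) + H (ZMod.unitsMap (dvd_mul_right 5 q) x) ≠ 0) = 4 * #SG := by
      rw [card_eq_sum_card_fibre]
      have hfib : ∀ b : (ZMod q)ˣ, #((univ.filter fun x : (ZMod (5 * q))ˣ ↦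
          G (ZMod.unitsMap (dvd_mul_left q 5) x) + H (ZMod.unitsMap (dvd_mul_right 5 q) x) ≠ 0).filter
            fun x ↦ ZMod.unitsMap (dvd_mul_left q 5) x = b) = if G b ≠ 0 then 4 else 0 := by
        intro b
        by_cases hb : G b ≠ 0
        · rw [if_pos hb]
          have : ((univ.filter fun x : (ZMod (5 * q))ˣ ↦
              G (ZMod.unitsMap (dvd_mul_left q 5) x) + H (ZMod.unitsMap (dvd_mul_right 5 q) x) ≠ 0).filter
                fun x ↦ ZMod.unitsMap (dvd_mul_left q 5) x = b) =
              univ.filter fun x : (ZMod (5 * q))ˣ ↦ ZMod.unitsMap (dvd_mul_left q 5) x = b := by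
            ext x
            simp only [mem_filter, mem_univ, true_and, and_iff_right_iff_imp]
            intro hx
            rw [hx, hH0, add_zero]; exact hb
          rw [this, card_fibre hpq b]
        · rw [if_neg hb]
          rw [Finset.card_eq_zero, Finset.filter_eq_empty_iff]
          intro x hx hxb
          simp only [mem_filter, mem_univ, true_and] at hx
          rw [hxb, hH0, add_zero] at hx
          exact hb hx
      rw [Finset.sum_congr rfl fun b _ ↦ hfib b, Finset.sum_ite, Finset.sum_const_zero, add_zero,
        Finset.sum_const, smul_eq_mul, mul_comm]
    have hSG3 : #SG ≤ 3 := by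
      have := hsupp_le; rw [hsupp_eq] at this; omega
    -- an element `b₀` of the support and the involution without fixed points: `#SG` is even
    obtain ⟨b₀, hb₀⟩ := hG0
    have hb₀S : b₀ ∈ SG := by simp [hSG, hb₀]
    have hSG2 : SG = {b₀, -b₀} := by
      -- `{b₀, -b₀} ⊆ SG`, and a third element would bring its negative too
      have hsub : ({b₀, -b₀} : Finset (ZMod q)ˣ) ⊆ SG := by
        intro b hb
        simp only [mem_insert, mem_singleton] at hb
        rcases hb with rfl | rfl
        · exact hb₀S
        · exact (hSGneg b₀).mp hb₀S
      by_contra hne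
      have hss : ({b₀, -b₀} : Finset (ZMod q)ˣ) ⊂ SG := lt_of_le_of_ne hsub (Ne.symm hne)
      obtain ⟨b, hbS, hbnot⟩ := Finset.exists_of_ssubset hss
      have hbnot' : -b ∉ ({b₀, -b₀} : Finset (ZMod q)ˣ) := by
        simp only [mem_insert, mem_singleton, not_or] at hbnot ⊢
        exact ⟨fun h ↦ hbnot.2 (by rw [← h, neg_neg]), fun h ↦ hbnot.1 (neg_injective h)⟩
      have h4 : ({b₀, -b₀, b, -b} : Finset (ZMod q)ˣ) ⊆ SG := by
        intro x hx
        simp only [mem_insert, mem_singleton] at hx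
        rcases hx with rfl | rfl | rfl | rfl
        · exact hb₀S
        · exact (hSGneg b₀).mp hb₀S
        · exact hbS
        · exact (hSGneg b).mp hbS
      have hcard4 : #({b₀, -b₀, b, -b} : Finset (ZMod q)ˣ) = 4 := by
        simp only [mem_insert, mem_singleton, not_or] at hbnot hbnot'
        rw [card_insert_of_notMem, card_insert_of_notMem, card_pair (hfix b)]
        · simp only [mem_insert, mem_singleton, not_or]
          exact ⟨fun h ↦ hbnot.2 h.symm, fun h ↦ hbnot'.2 h.symm⟩
        · simp only [mem_insert, mem_singleton, not_or]
          exact ⟨hfix b₀, fun h ↦ hbnot.1 h.symm, fun h ↦ hbnot'.1 h.symm⟩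
      have := card_le_card h4
      omega
    -- the value of `o` on the fibre of `b₀` is a non-zero integer; orient it
    have hval : ∀ x : (ZMod (5 * q))ˣ, ZMod.unitsMap (dvd_mul_left q 5) x = b₀ →
        (Multiset.count (x : ZMod (5 * q)) s : ℂ) - Multiset.count (-(x : ZMod (5 * q))) s = G b₀ :=
      fun x hx ↦ by rw [ho' x, hx]
    have hoff : ∀ x : (ZMod (5 * q))ˣ, ZMod.unitsMap (dvd_mul_left q 5) x ≠ b₀ →
        ZMod.unitsMap (dvd_mul_left q 5) x ≠ -b₀ →
        Multiset.count (x : ZMod (5 * q)) s = Multiset.count (-(x : ZMod (5 * q))) s := by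
      intro x h1 h2
      have hx : ZMod.unitsMap (dvd_mul_left q 5) x ∉ SG := by
        rw [hSG2]; simp [h1, h2]
      simp only [hSG, mem_filter, mem_univ, true_and, not_not] at hx
      have h := ho' x
      rw [hx, sub_eq_zero] at h
      exact_mod_cast h
    -- pick `x₀` in the fibre of `b₀` and read the sign of `c(x₀) - c(-x₀)`
    obtain ⟨x₀, -, hx₀⟩ := exists_unit_of_unitsMap hpq (1 : (ZMod 5)ˣ) b₀
    rcases lt_or_ge (Multiset.count (-(x₀ : ZMod (5 * q))) s) (Multiset.count (x₀ : ZMod (5 * q)) s) with hlt | hge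
    · -- `G b₀ > 0`: the fibre of `b₀` is the occupied one
      refine ⟨b₀, fun x hx ↦ ?_, hoff⟩
      have h := hval x hx
      rw [← hval x₀ hx₀] at h
      have h' : (Multiset.count (x : ZMod (5 * q)) s : ℤ) - Multiset.count (-(x : ZMod (5 * q))) s =
          (Multiset.count (x₀ : ZMod (5 * q)) s : ℤ) - Multiset.count (-(x₀ : ZMod (5 * q))) s := by
        exact_mod_cast h
      omega
    · -- `G b₀ < 0` (it is non-zero): the fibre of `-b₀` is the occupied one
      have hne : Multiset.count (-(x₀ : ZMod (5 * q))) s ≠ Multiset.count (x₀ : ZMod (5 * q)) s := by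
        intro heq
        apply hb₀
        rw [← hval x₀ hx₀, heq, sub_self]
      refine ⟨-b₀, fun x hx ↦ ?_, fun x h1 h2 ↦ hoff x (by rw [neg_neg] at h2; exact h2) h1⟩
      -- `-x` lies in the fibre of `b₀`
      have hx' : ZMod.unitsMap (dvd_mul_left q 5) (-x) = b₀ := by rw [unitsMap_neg, hx, neg_neg]
      have h := hval (-x) hx'
      rw [← hval x₀ hx₀, Units.val_neg, neg_neg] at h
      have h' : (Multiset.count (-(x : ZMod (5 * q))) s : ℤ) - Multiset.count (x : ZMod (5 * q)) s =
          (Multiset.count (x₀ : ZMod (5 * q)) s : ℤ) - Multiset.count (-(x₀ : ZMod (5 * q))) s := by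
        exact_mod_cast h
      omega

end Level5q

end Summit.HodgeConjecture.HodgeConjecture.Theorems.CancelByAnyClaimLattice.FiveQ
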